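import Literature.Computability.QuantumComplexity.QuantumMarginals
import Literature.LinearAlgebra.Matrix.JensenOperatorInequality
import Literature.LinearAlgebra.Matrix.RelativeModularOperator
import HarnessLib

/-!
# Monotonicity of the quantum relative entropy under the partial trace (Lindblad 1975; Petz's
# relative-modular-operator proof) — the positive definite case

Topic `InformationTheory/Entropy`, namespace `Literature.InformationTheory.Entropy`.

For positive definite `ρ, σ` on `ℋ_A ⊗ ℋ_B` (complex matrices indexed by `m × n`) and the partial
trace `Tr_A = traceLeft` over the FIRST factor,
`Re Tr (Tr_A ρ (log Tr_A ρ − log Tr_A σ)) ≤ Re Tr (ρ (log ρ − log σ))`, i.e.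
`S(Tr_A ρ ‖ Tr_A σ) ≤ S(ρ ‖ σ)` [cite: Lindblad1975, Lemma 2 p.149]
[cite: NielsenChuang2010, Theorem 11.17 eq. (11.125) p.524], proved here by Petz's
relative-modular-operator method [cite: Petz2008, Theorems 3.9–3.10 and their proof,
eqs. (3.22)–(3.26)] [cite: Petz2003, §3] in the case "all the densities have only non-zero
eigenvalues" (Petz: "The general case can be covered by an approximation argument" — that
argument, and the named fact `relEntropy_partialTrace_le` it discharges, live in the consumer file
`VonNeumannEntropyInequalities.lean`).

## The proof (Petz 2008, proof of Theorem 3.10, with `𝓔 = Tr_A`, `f = −log`)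

On the vectorised Hilbert–Schmidt spaces (`Matrix.vec`), the relative modular operators are the
Kronecker matrices `Δ = (ρ⁻¹)ᵀ ⊗ₖ σ` and `Δ₀ = ((Tr_A ρ)⁻¹)ᵀ ⊗ₖ Tr_A σ`
(`Literature/LinearAlgebra/Matrix/RelativeModularOperator.lean`), and
`S(ρ‖σ) = −⟨vec ρ^{1/2}, log Δ vec ρ^{1/2}⟩` (Araki's formula, ibid.).  Petz's operator
`V (x 𝓔(ρ)^{1/2}) = 𝓔*(x) ρ^{1/2}` [cite: Petz2008, eq. (3.24)], for `𝓔 = Tr_A` (so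
`𝓔*(x) = 1 ⊗ x`), is the matrix `V : vec Y ↦ vec ((1 ⊗ₖ Y T) R)` with `R = ρ^{1/2}` and
`T = (Tr_A ρ)^{-1/2}` (written as an explicit `Matrix.of`; no definition is introduced), and:

* `Vᴴ V = 1` — it is an ISOMETRY (Petz: a contraction; equality because `𝓔* = 1 ⊗ ·` is
  multiplicative), by the defining property `Tr (ρ (1 ⊗ Z)) = Tr (Tr_A ρ · Z)`;
* `V vec (Tr_A ρ)^{1/2} = vec ρ^{1/2}` ("Since `V 𝓔(ρ₁)^{1/2} = ρ₁^{1/2}`", ibid.);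
* `Vᴴ Δ V = Δ₀` (Petz (3.25) `V* Δ V ≤ Δ₀`, with equality for the partial trace);
* hence, by Jensen's operator inequality for the operator concave `log`
  (`Literature/LinearAlgebra/Matrix/JensenOperatorInequality.lean`,
  `re_star_dotProduct_log_mulVec_le`):
  `⟨vec ρ^{1/2}, log Δ vec ρ^{1/2}⟩ ≤ ⟨vec ρ₀^{1/2}, log Δ₀ vec ρ₀^{1/2}⟩`, which is the claim by
  Araki's formula on both sides [cite: Petz2008, eq. (3.26) and the display after it].

## Contents (all PROVED; no public definition, no named fact)

* `trace_mul_one_kronecker` — `Tr (ρ (1 ⊗ₖ Z)) = Tr (Tr_A ρ · Z)`;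
* `posDef_traceLeft` — `Tr_A` of a positive definite matrix is positive definite;
* `cfc_sqrt_mul_self`, `commute_cfc_sqrt_inv` — the square root `cfc Real.sqrt ρ`;
* **`re_trace_traceLeft_mul_log_sub_log_le`** — the monotonicity inequality for positive definite
  `ρ, σ` under `traceLeft`.

## References

* G. Lindblad, *Completely positive maps and entropy inequalities*, Commun. Math. Phys. 40 (1975)
  147–151, Lemma 2. [Lindblad1975]
* D. Petz, *Quantum Information Theory and Quantum Statistics* (Springer 2008), Theorems 3.9,
  3.10, eqs. (3.22)–(3.26). [Petz2008]
* D. Petz, *Monotonicity of quantum relative entropy revisited*, Rev. Math. Phys. 15 (2003)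
  79–91, §3. [Petz2003]
* M. A. Nielsen, I. L. Chuang, *Quantum Computation and Quantum Information* (CUP 2010),
  §2.4.3 eq. (2.178) (partial trace), Theorem 11.17. [NielsenChuang2010]
-/

noncomputable section

open Matrix
open scoped MatrixOrder ComplexOrder Kronecker

namespace Literature.InformationTheory.Entropy

open Literature.Computability.QuantumComplexity (traceLeft traceLeft_apply)
open Literature.LinearAlgebra.Matrix

variable {m n : Type*} [Fintype m] [Fintype n] [DecidableEq m] [DecidableEq n]

/-! ### The defining property of the partial trace and its positivity -/

omit [DecidableEq n] in
/-- The defining property of `Tr_A = traceLeft`: `Tr (ρ (1 ⊗ Z)) = Tr (Tr_A ρ · Z)` for every `Z`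
on the second factor. [cite: NielsenChuang2010, §2.4.3 eq. (2.178)] -/
theorem trace_mul_one_kronecker (ρ : Matrix (m × n) (m × n) ℂ) (Z : Matrix n n ℂ) :
    (ρ * ((1 : Matrix m m ℂ) ⊗ₖ Z)).trace = (traceLeft ρ * Z).trace := by
  have lhs : (ρ * ((1 : Matrix m m ℂ) ⊗ₖ Z)).trace =
      ∑ a : m, ∑ b : n, ∑ b' : n, ρ (a, b) (a, b') * Z b' b := by
    simp only [Matrix.trace, Matrix.diag, Matrix.mul_apply, Fintype.sum_prod_type,
      Matrix.kronecker_apply, Matrix.one_apply, ite_mul, one_mul, zero_mul, mul_ite, mul_zero]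
    refine Finset.sum_congr rfl fun a _ => Finset.sum_congr rfl fun b _ => ?_
    rw [Finset.sum_comm]
    refine Finset.sum_congr rfl fun b' _ => ?_
    simp only [Finset.sum_ite_eq', Finset.mem_univ, if_true]
  have rhs : (traceLeft ρ * Z).trace = ∑ b : n, ∑ b' : n, ∑ a : m, ρ (a, b) (a, b') * Z b' b := by
    simp only [Matrix.trace, Matrix.diag, Matrix.mul_apply, traceLeft_apply, Finset.sum_mul]
  rw [lhs, rhs, Finset.sum_comm]
  refine Finset.sum_congr rfl fun b _ => ?_
  rw [Finset.sum_comm]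

/-! The isometric slice embeddings `E_a : ℋ_B → ℋ_A ⊗ ℋ_B`, `y ↦ e_a ⊗ y`, are the matrices
`(1 : Matrix (m × n) (m × n) ℂ).submatrix id (Prod.mk a)` (the columns `(a, ·)` of the identity). -/

omit [Fintype m] [Fintype n] in
/-- Entries of the slice embedding `E_a`: `(E_a)_{q,b} = [q = (a,b)]`. [folklore] -/
private theorem sliceMat_apply (a : m) (q : m × n) (b : n) :
    ((1 : Matrix (m × n) (m × n) ℂ).submatrix id (Prod.mk a)) q b = if q = (a, b) then 1 else 0 := by
  rw [Matrix.submatrix_apply, Matrix.one_apply]; rfl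

omit [Fintype m] [Fintype n] in
/-- Entries of `E_aᴴ`. [folklore] -/
private theorem conjTranspose_sliceMat_apply (a : m) (b : n) (q : m × n) :
    ((1 : Matrix (m × n) (m × n) ℂ).submatrix id (Prod.mk a))ᴴ b q = if q = (a, b) then 1 else 0 := by
  rw [conjTranspose_apply, sliceMat_apply]
  split_ifs <;> simp

omit [Fintype m] in
/-- `(E_a y)_{(a,b)} = y_b`. [folklore] -/
private theorem sliceMat_mulVec_apply (a : m) (y : n → ℂ) (b : n) :
    (((1 : Matrix (m × n) (m × n) ℂ).submatrix id (Prod.mk a)) *ᵥ y) (a, b) = y b := by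
  simp only [Matrix.mulVec, dotProduct, sliceMat_apply, Prod.mk.injEq, true_and, ite_mul, one_mul,
    zero_mul, Finset.sum_ite_eq, Finset.mem_univ, if_true]

omit [Fintype m] in
/-- `E_a` is injective. [folklore] -/
private theorem sliceMat_mulVec_injective (a : m) :
    Function.Injective ((1 : Matrix (m × n) (m × n) ℂ).submatrix id (Prod.mk a)).mulVec := by
  intro y y' h
  funext b
  rw [← sliceMat_mulVec_apply a y b, ← sliceMat_mulVec_apply a y' b, h]

/-- `(E_aᴴ ρ E_a)_{b b'} = ρ_{(a,b),(a,b')}`. [folklore] -/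
private theorem conjTranspose_sliceMat_mul_mul_apply (a : m) (ρ : Matrix (m × n) (m × n) ℂ)
    (b b' : n) :
    (((1 : Matrix (m × n) (m × n) ℂ).submatrix id (Prod.mk a))ᴴ * ρ * ((1 : Matrix (m × n) (m × n) ℂ).submatrix id (Prod.mk a))) b b' =
      ρ (a, b) (a, b') := by
  simp only [Matrix.mul_apply, conjTranspose_sliceMat_apply, sliceMat_apply, ite_mul, one_mul,
    zero_mul, Finset.sum_ite_eq', Finset.mem_univ, if_true, mul_ite, mul_one, mul_zero]

/-- `Tr_A ρ = Σ_a E_aᴴ ρ E_a` for the slice isometries `E_a y = e_a ⊗ y`.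
[cite: NielsenChuang2010, §2.4.3 eq. (2.178)] [folklore] -/
private theorem traceLeft_eq_sum_conjTranspose_mul_mul (ρ : Matrix (m × n) (m × n) ℂ) :
    traceLeft ρ = ∑ a : m, ((1 : Matrix (m × n) (m × n) ℂ).submatrix id (Prod.mk a))ᴴ * ρ * ((1 : Matrix (m × n) (m × n) ℂ).submatrix id (Prod.mk a)) := by
  ext b b'
  rw [traceLeft_apply, Matrix.sum_apply]
  simp only [conjTranspose_sliceMat_mul_mul_apply]

/-- **The partial trace of a positive definite matrix is positive definite** (over a nonempty
traced factor). [cite: NielsenChuang2010, §2.4.3] -/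
theorem posDef_traceLeft [Nonempty m] {ρ : Matrix (m × n) (m × n) ℂ} (hρ : ρ.PosDef) :
    (traceLeft ρ).PosDef := by
  rw [traceLeft_eq_sum_conjTranspose_mul_mul]
  exact Matrix.posDef_sum Finset.univ_nonempty fun a _ =>
    hρ.conjTranspose_mul_mul_same (sliceMat_mulVec_injective a)

/-! ### Square roots -/

section Sqrt

variable {d : Type*} [Fintype d] [DecidableEq d]

/-- `(√ρ)² = ρ` for a positive semidefinite matrix (`√ρ = cfc Real.sqrt ρ`).
[cite: Petz2008, §11.3] -/
theorem cfc_sqrt_mul_self {ρ : Matrix d d ℂ} (hρ : ρ.PosSemidef) :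
    cfc Real.sqrt ρ * cfc Real.sqrt ρ = ρ := by
  have hρ' : IsSelfAdjoint ρ := hρ.1
  rw [← cfc_mul Real.sqrt Real.sqrt ρ (cfc_continuousOn ρ _) (cfc_continuousOn ρ _)]
  conv_rhs => rw [← cfc_id' ℝ ρ]
  refine cfc_congr fun x hx => ?_
  exact Real.mul_self_sqrt (spectrum_nonneg_of_nonneg (Matrix.nonneg_iff_posSemidef.mpr hρ) hx)

/-- `√ρ` commutes with `ρ⁻¹`. [cite: Petz2008, §11.3] -/
theorem commute_cfc_sqrt_inv (ρ : Matrix d d ℂ) : Commute (cfc Real.sqrt ρ) ρ⁻¹ := by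
  have h : Commute ρ ρ⁻¹ := by
    by_cases hu : IsUnit ρ.det
    · show ρ * ρ⁻¹ = ρ⁻¹ * ρ
      rw [Matrix.mul_nonsing_inv _ hu, Matrix.nonsing_inv_mul _ hu]
    · rw [Matrix.nonsing_inv_apply_not_isUnit _ hu]; exact Commute.zero_right ρ
  exact commute_cfc_of_commute h Real.sqrt

/-- `√ρ ρ⁻¹ √ρ = 1` for positive definite `ρ`. [cite: Petz2008, §11.3] -/
theorem cfc_sqrt_mul_inv_mul_cfc_sqrt {ρ : Matrix d d ℂ} (hρ : ρ.PosDef) :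
    cfc Real.sqrt ρ * ρ⁻¹ * cfc Real.sqrt ρ = 1 := by
  rw [Matrix.mul_assoc, ← (commute_cfc_sqrt_inv ρ).eq, ← Matrix.mul_assoc,
    cfc_sqrt_mul_self hρ.posSemidef, Matrix.mul_nonsing_inv _ (isUnit_iff_ne_zero.mpr hρ.det_pos.ne')]

end Sqrt

/-! ### Petz's isometry for the partial trace -/

/-! Petz's operator for `𝓔 = Tr_A` on the vectorised spaces, `vec Y ↦ vec ((1 ⊗ₖ Y) K)` (with
`K = (1 ⊗ₖ T) R` below), is the explicit matrix
`Matrix.of fun q p => if p.2 = q.2.2 then K (q.2.1, p.1) q.1 else 0` (no definition is introduced). -/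

/-- Petz's operator acts as `vec Y ↦ vec ((1 ⊗ₖ Y) K)`. [cite: Petz2008, eq. (3.24)] [folklore] -/
private theorem isoMat_mulVec_vec (K : Matrix (m × n) (m × n) ℂ) (Y : Matrix n n ℂ) :
    (Matrix.of fun (q : (m × n) × (m × n)) (p : n × n) => if p.2 = q.2.2 then K (q.2.1, p.1) q.1 else (0 : ℂ)) *ᵥ vec Y = vec (((1 : Matrix m m ℂ) ⊗ₖ Y) * K) := by
  ext ⟨⟨a', b'⟩, ⟨a, b⟩⟩
  have lhs : ((Matrix.of fun (q : (m × n) × (m × n)) (p : n × n) => if p.2 = q.2.2 then K (q.2.1, p.1) q.1 else (0 : ℂ)) *ᵥ vec Y) ((a', b'), (a, b)) =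
      ∑ c : n, K (a, c) (a', b') * Y b c := by
    rw [Matrix.mulVec, dotProduct, Fintype.sum_prod_type]
    refine Finset.sum_congr rfl fun c _ => ?_
    simp only [Matrix.of_apply, Matrix.vec, ite_mul, zero_mul, Finset.sum_ite_eq',
      Finset.mem_univ, if_true]
  have rhs : vec (((1 : Matrix m m ℂ) ⊗ₖ Y) * K) ((a', b'), (a, b)) =
      ∑ c : n, Y b c * K (a, c) (a', b') := by
    rw [Matrix.vec, Matrix.mul_apply, Fintype.sum_prod_type, Finset.sum_comm]
    refine Finset.sum_congr rfl fun c _ => ?_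
    simp only [Matrix.kronecker_apply, Matrix.one_apply, ite_mul, one_mul, zero_mul,
      Finset.sum_ite_eq, Finset.mem_univ, if_true]
  rw [lhs, rhs]
  exact Finset.sum_congr rfl fun c _ => mul_comm _ _

omit [DecidableEq m] [DecidableEq n] in
/-- Two operators on the vectorised space agree if their matrix elements between vectorised
matrices agree. [folklore] -/
private theorem ext_of_vec {M M' : Matrix (n × n) (n × n) ℂ}
    (h : ∀ X Y : Matrix n n ℂ, star (vec X) ⬝ᵥ (M *ᵥ vec Y) = star (vec X) ⬝ᵥ (M' *ᵥ vec Y)) :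
    M = M' := by
  classical
  ext p q
  have := h (Matrix.single p.2 p.1 1) (Matrix.single q.2 q.1 1)
  simpa [Matrix.vec_single, Matrix.mulVec_single_one, ← Pi.single_star] using this

omit [Fintype m] [Fintype n] [DecidableEq m] [DecidableEq n] in
/-- `⟨x, (Vᴴ A V) y⟩ = ⟨V x, A (V y)⟩`. [folklore] -/
private theorem star_dotProduct_conjTranspose_mul_mul_mulVec {N M : Type*} [Fintype N] [Fintype M]
    (V : Matrix N M ℂ) (A : Matrix N N ℂ) (x y : M → ℂ) :
    star x ⬝ᵥ ((Vᴴ * A * V) *ᵥ y) = star (V *ᵥ x) ⬝ᵥ (A *ᵥ (V *ᵥ y)) := by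
  rw [star_mulVec, ← dotProduct_mulVec, Matrix.mulVec_mulVec, Matrix.mulVec_mulVec]

omit [Fintype m] [Fintype n] [DecidableEq m] [DecidableEq n] in
/-- `⟨x, (Vᴴ V) y⟩ = ⟨V x, V y⟩`. [folklore] -/
private theorem star_dotProduct_conjTranspose_mul_mulVec {N M : Type*} [Fintype N] [Fintype M]
    (V : Matrix N M ℂ) (x y : M → ℂ) :
    star x ⬝ᵥ ((Vᴴ * V) *ᵥ y) = star (V *ᵥ x) ⬝ᵥ (V *ᵥ y) := by
  rw [star_mulVec, ← dotProduct_mulVec, Matrix.mulVec_mulVec]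

section Isometry

variable {ρ : Matrix (m × n) (m × n) ℂ} {R : Matrix (m × n) (m × n) ℂ} {T : Matrix n n ℂ}

omit [DecidableEq n] in
/-- `(V X)ᴴ (V Y) = R (1 ⊗ (T Xᴴ Y T)) R`. [cite: Petz2008, eq. (3.24) and the display after it]
[folklore] -/
private theorem conjTranspose_isoApply_mul_isoApply (hRh : Rᴴ = R) (hTh : Tᴴ = T)
    (X Y : Matrix n n ℂ) :
    (((1 : Matrix m m ℂ) ⊗ₖ X) * (((1 : Matrix m m ℂ) ⊗ₖ T) * R))ᴴ *
        (((1 : Matrix m m ℂ) ⊗ₖ Y) * (((1 : Matrix m m ℂ) ⊗ₖ T) * R)) =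
      R * ((1 : Matrix m m ℂ) ⊗ₖ (T * Xᴴ * Y * T)) * R := by
  rw [conjTranspose_mul, conjTranspose_mul, conjTranspose_kronecker, conjTranspose_kronecker,
    conjTranspose_one, hRh, hTh]
  simp only [Matrix.mul_assoc]
  rw [← Matrix.mul_assoc ((1 : Matrix m m ℂ) ⊗ₖ T), ← mul_kronecker_mul, Matrix.mul_one,
    ← Matrix.mul_assoc ((1 : Matrix m m ℂ) ⊗ₖ (T * Xᴴ)), ← mul_kronecker_mul, Matrix.mul_one,
    ← Matrix.mul_assoc ((1 : Matrix m m ℂ) ⊗ₖ (T * Xᴴ * Y)), ← mul_kronecker_mul, Matrix.mul_one]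
  simp only [Matrix.mul_assoc]

omit [Fintype m] [DecidableEq m] in
/-- `Tr (B (T Xᴴ Y T)) = Tr (Xᴴ Y)` when `T B T = 1`. [folklore] -/
private theorem trace_mul_sandwich_eq (B : Matrix n n ℂ) (hT : T * B * T = 1) (X Y : Matrix n n ℂ) :
    (B * (T * Xᴴ * Y * T)).trace = (Xᴴ * Y).trace := by
  calc (B * (T * Xᴴ * Y * T)).trace = ((T * Xᴴ * Y * T) * B).trace := Matrix.trace_mul_comm _ _
    _ = ((T * Xᴴ * Y) * (T * B)).trace := by simp only [Matrix.mul_assoc]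
    _ = ((T * B) * (T * Xᴴ * Y)).trace := Matrix.trace_mul_comm _ _
    _ = ((T * B * T) * (Xᴴ * Y)).trace := by simp only [Matrix.mul_assoc]
    _ = (Xᴴ * Y).trace := by rw [hT, Matrix.one_mul]

/-- **Petz's operator is an isometry for the partial trace**: `Vᴴ V = 1`.
[cite: Petz2008, eq. (3.24) and the display after it] -/
private theorem isoMat_conjTranspose_mul_self (hRh : Rᴴ = R) (hTh : Tᴴ = T) (hRR : R * R = ρ)
    (hT : T * traceLeft ρ * T = 1) :
    (Matrix.of fun (q : (m × n) × (m × n)) (p : n × n) => if p.2 = q.2.2 then (((1 : Matrix m m ℂ) ⊗ₖ T) * R) (q.2.1, p.1) q.1 else (0 : ℂ))ᴴ *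
      (Matrix.of fun (q : (m × n) × (m × n)) (p : n × n) => if p.2 = q.2.2 then (((1 : Matrix m m ℂ) ⊗ₖ T) * R) (q.2.1, p.1) q.1 else (0 : ℂ)) = 1 := by
  refine ext_of_vec fun X Y => ?_
  rw [Matrix.one_mulVec, star_dotProduct_conjTranspose_mul_mulVec, isoMat_mulVec_vec,
    isoMat_mulVec_vec, star_vec_dotProduct_vec, star_vec_dotProduct_vec,
    conjTranspose_isoApply_mul_isoApply hRh hTh, Matrix.trace_mul_cycle R, hRR,
    trace_mul_one_kronecker, trace_mul_sandwich_eq _ hT]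

/-- `V vec (Tr_A ρ)^{1/2} = vec ρ^{1/2}`. [cite: Petz2008, proof of Theorem 3.10] -/
private theorem isoMat_mulVec_vec_sqrt {RB : Matrix n n ℂ} (hRBT : RB * T = 1) :
    (Matrix.of fun (q : (m × n) × (m × n)) (p : n × n) => if p.2 = q.2.2 then (((1 : Matrix m m ℂ) ⊗ₖ T) * R) (q.2.1, p.1) q.1 else (0 : ℂ)) *ᵥ vec RB =
      vec R := by
  rw [isoMat_mulVec_vec, ← Matrix.mul_assoc, ← mul_kronecker_mul, Matrix.mul_one, hRBT,
    one_kronecker_one, Matrix.one_mul]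

/-- **`Vᴴ Δ V = Δ₀`** for the relative modular operators of `(ρ, σ)` and of their partial traces.
[cite: Petz2008, eq. (3.25)] -/
private theorem isoMat_conjTranspose_mul_relativeModular_mul (hRh : Rᴴ = R) (hTh : Tᴴ = T)
    (hR : R * ρ⁻¹ * R = 1) (hTT : T * T = (traceLeft ρ)⁻¹) (σ : Matrix (m × n) (m × n) ℂ) :
    (Matrix.of fun (q : (m × n) × (m × n)) (p : n × n) => if p.2 = q.2.2 then (((1 : Matrix m m ℂ) ⊗ₖ T) * R) (q.2.1, p.1) q.1 else (0 : ℂ))ᴴ *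
        ((ρ⁻¹)ᵀ ⊗ₖ σ) *
        (Matrix.of fun (q : (m × n) × (m × n)) (p : n × n) => if p.2 = q.2.2 then (((1 : Matrix m m ℂ) ⊗ₖ T) * R) (q.2.1, p.1) q.1 else (0 : ℂ)) =
      ((traceLeft ρ)⁻¹)ᵀ ⊗ₖ traceLeft σ := by
  refine ext_of_vec fun X Y => ?_
  rw [star_dotProduct_conjTranspose_mul_mul_mulVec, isoMat_mulVec_vec, isoMat_mulVec_vec,
    relativeModular_mulVec_vec, relativeModular_mulVec_vec, star_vec_dotProduct_vec,
    star_vec_dotProduct_vec]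
  -- left: ((VX)ᴴ * (σ * VY * ρ⁻¹)).trace
  have hVX : (((1 : Matrix m m ℂ) ⊗ₖ X) * (((1 : Matrix m m ℂ) ⊗ₖ T) * R))ᴴ =
      R * ((1 : Matrix m m ℂ) ⊗ₖ (T * Xᴴ)) := by
    rw [conjTranspose_mul, conjTranspose_mul, conjTranspose_kronecker, conjTranspose_kronecker,
      conjTranspose_one, hRh, hTh, Matrix.mul_assoc, ← mul_kronecker_mul, Matrix.mul_one]
  have hVY : ((1 : Matrix m m ℂ) ⊗ₖ Y) * (((1 : Matrix m m ℂ) ⊗ₖ T) * R) =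
      ((1 : Matrix m m ℂ) ⊗ₖ (Y * T)) * R := by
    rw [← Matrix.mul_assoc, ← mul_kronecker_mul, Matrix.mul_one]
  rw [hVX, hVY]
  calc (R * ((1 : Matrix m m ℂ) ⊗ₖ (T * Xᴴ)) * (σ * (((1 : Matrix m m ℂ) ⊗ₖ (Y * T)) * R) * ρ⁻¹)).trace
      = (R * (((1 : Matrix m m ℂ) ⊗ₖ (T * Xᴴ)) * σ * ((1 : Matrix m m ℂ) ⊗ₖ (Y * T))) *
          (R * ρ⁻¹)).trace := by simp only [Matrix.mul_assoc]
    _ = ((R * ρ⁻¹) * R * (((1 : Matrix m m ℂ) ⊗ₖ (T * Xᴴ)) * σ *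
          ((1 : Matrix m m ℂ) ⊗ₖ (Y * T)))).trace := Matrix.trace_mul_cycle _ _ _
    _ = (((1 : Matrix m m ℂ) ⊗ₖ (T * Xᴴ)) * σ * ((1 : Matrix m m ℂ) ⊗ₖ (Y * T))).trace := by
          rw [hR, Matrix.one_mul]
    _ = (((1 : Matrix m m ℂ) ⊗ₖ (Y * T)) * ((1 : Matrix m m ℂ) ⊗ₖ (T * Xᴴ)) * σ).trace :=
          Matrix.trace_mul_cycle _ _ _
    _ = (σ * ((1 : Matrix m m ℂ) ⊗ₖ (Y * T * (T * Xᴴ)))).trace := by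
          rw [← mul_kronecker_mul, Matrix.mul_one, Matrix.trace_mul_comm]
    _ = (traceLeft σ * (Y * T * (T * Xᴴ))).trace := trace_mul_one_kronecker _ _
    _ = (traceLeft σ * Y * (traceLeft ρ)⁻¹ * Xᴴ).trace := by
          rw [← hTT]; simp only [Matrix.mul_assoc]
    _ = (Xᴴ * (traceLeft σ * Y * (traceLeft ρ)⁻¹)).trace := Matrix.trace_mul_comm _ _

end Isometry

/-! ### The monotonicity inequality (positive definite case) -/

/-- **Monotonicity of the quantum relative entropy under the partial trace, positive definite
case** (Lindblad 1975, Lemma 2; Petz's proof): for positive definite `ρ, σ` on `ℋ_A ⊗ ℋ_B`,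
`Re Tr (Tr_A ρ (log Tr_A ρ − log Tr_A σ)) ≤ Re Tr (ρ (log ρ − log σ))` (`log = cfc Real.log`,
`Tr_A = traceLeft`). [cite: Lindblad1975, Lemma 2 p.149] [cite: Petz2008, Theorem 3.9]
[cite: NielsenChuang2010, Theorem 11.17 eq. (11.125)] -/
theorem re_trace_traceLeft_mul_log_sub_log_le {ρ σ : Matrix (m × n) (m × n) ℂ}
    (hρ : ρ.PosDef) (hσ : σ.PosDef) :
    ((traceLeft ρ * (cfc Real.log (traceLeft ρ) - cfc Real.log (traceLeft σ))).trace).re ≤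
      ((ρ * (cfc Real.log ρ - cfc Real.log σ)).trace).re := by
  rcases isEmpty_or_nonempty m with hm | hm
  · -- `m` empty: both sides are traces over empty index types / of the zero matrix
    have h0 : traceLeft ρ = 0 := by
      ext b b'
      simp [traceLeft_apply]
    have h1 : (ρ * (cfc Real.log ρ - cfc Real.log σ)).trace = 0 := by
      simp [Matrix.trace]
    rw [h0, h1, Matrix.zero_mul, Matrix.trace_zero]
  -- the data of Petz's proof
  have hρB : (traceLeft ρ).PosDef := posDef_traceLeft hρ
  have hσB : (traceLeft σ).PosDef := posDef_traceLeft hσ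
  set R : Matrix (m × n) (m × n) ℂ := cfc Real.sqrt ρ with hRdef
  set RB : Matrix n n ℂ := cfc Real.sqrt (traceLeft ρ) with hRBdef
  set T : Matrix n n ℂ := RB * (traceLeft ρ)⁻¹ with hTdef
  have hRh : Rᴴ = R := (isHermitian_cfc ρ Real.sqrt).eq
  have hRBh : RBᴴ = RB := (isHermitian_cfc (traceLeft ρ) Real.sqrt).eq
  have hRR : R * R = ρ := cfc_sqrt_mul_self hρ.posSemidef
  have hRBRB : RB * RB = traceLeft ρ := cfc_sqrt_mul_self hρB.posSemidef
  have hR : R * ρ⁻¹ * R = 1 := cfc_sqrt_mul_inv_mul_cfc_sqrt hρ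
  have hcomm : Commute RB (traceLeft ρ)⁻¹ := commute_cfc_sqrt_inv (traceLeft ρ)
  have hunit : IsUnit (traceLeft ρ).det := isUnit_iff_ne_zero.mpr hρB.det_pos.ne'
  have hTh : Tᴴ = T := by
    rw [hTdef, conjTranspose_mul, hRBh, (hρB.isHermitian.inv).eq, hcomm.eq]
  have hRBT : RB * T = 1 := by
    rw [hTdef, ← Matrix.mul_assoc, hRBRB, Matrix.mul_nonsing_inv _ hunit]
  have hT : T * traceLeft ρ * T = 1 := by
    rw [hTdef, Matrix.mul_assoc RB, Matrix.nonsing_inv_mul _ hunit, Matrix.mul_one, ← Matrix.mul_assoc,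
      hRBRB, Matrix.mul_nonsing_inv _ hunit]
  have hTT : T * T = (traceLeft ρ)⁻¹ := by
    rw [hTdef]
    calc RB * (traceLeft ρ)⁻¹ * (RB * (traceLeft ρ)⁻¹)
        = RB * ((traceLeft ρ)⁻¹ * RB) * (traceLeft ρ)⁻¹ := by simp only [Matrix.mul_assoc]
      _ = RB * (RB * (traceLeft ρ)⁻¹) * (traceLeft ρ)⁻¹ := by rw [← hcomm.eq]
      _ = RB * RB * (traceLeft ρ)⁻¹ * (traceLeft ρ)⁻¹ := by simp only [Matrix.mul_assoc]
      _ = (traceLeft ρ)⁻¹ := by rw [hRBRB, Matrix.mul_nonsing_inv _ hunit, Matrix.one_mul]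
  -- the isometry and its three identities
  set V : Matrix ((m × n) × (m × n)) (n × n) ℂ :=
    (Matrix.of fun (q : (m × n) × (m × n)) (p : n × n) => if p.2 = q.2.2 then (((1 : Matrix m m ℂ) ⊗ₖ T) * R) (q.2.1, p.1) q.1 else (0 : ℂ)) with hVdef
  have hV : Vᴴ * V = 1 := isoMat_conjTranspose_mul_self hRh hTh hRR hT
  have hVRB : V *ᵥ vec RB = vec R := isoMat_mulVec_vec_sqrt hRBT
  have hVΔV : Vᴴ * ((ρ⁻¹)ᵀ ⊗ₖ σ) * V = ((traceLeft ρ)⁻¹)ᵀ ⊗ₖ traceLeft σ :=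
    isoMat_conjTranspose_mul_relativeModular_mul hRh hTh hR hTT σ
  -- Araki's formula on both sides and Jensen's operator inequality
  have hA := re_trace_mul_log_sub_log_eq_neg_re hρ hσ (isHermitian_cfc ρ Real.sqrt) hRR
  have hB := re_trace_mul_log_sub_log_eq_neg_re hρB hσB (isHermitian_cfc _ Real.sqrt) hRBRB
  simp only [RCLike.re_to_complex] at hA hB
  have hJ := re_star_dotProduct_log_mulVec_le V hV (posDef_relativeModular hρ hσ) (vec RB)
  rw [hVRB, hVΔV] at hJ
  rw [hA, hB]
  linarith

end Literature.InformationTheory.Entropy
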